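import Literature.Geometry.Lorentzian.KerrFarLeafEnergy
import HarnessLib

/-!
# The far-region identity for a general cut-off modified current `f (J^X + ¼ L_ϖ)[ψ̃]` between a
# lower graph and a leaf `Σ̃_t(h♯_{R₁})`, with a general smeared time profile

(family `gr`; infrastructure for the Morawetz / large-`r` and `r^p` estimates behind statement
**gr.S24** — Moschidis, arXiv:1509.08489, Lemma 4.1 and Thm. 5.1; Dafermos–Rodnianski–
Shlapentokh-Rothman, arXiv:1402.7034, §2.3 and Prop. 4.6.1; namespace
`Literature.Geometry.Lorentzian.Kerr`)

`Kerr.far_TCurrent_identity` (`KerrFarLeafEnergy.lean`) specialised the abstract identity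
`KerrSchild.cutoffModifiedCurrent_graphs_identity_timeCutoff` to the Killing multiplier `T`. Here
is the same discharge of the Kerr-specific hypotheses for an **arbitrary** multiplier `X` and
weight `ϖ` that are `C¹`, resp. `C²`, on the far region `{‖x⃗‖ > R_af}`, and an arbitrary `C¹`
profile `ζ` vanishing on `(−∞, 0]` (`χ` for energies, `χ'` for plate terms):

* `Kerr.far_cutoffCurrent_identity` (**proved**): for an admissible `ψ`, `0 ≤ s ≤ t`, `R' > R_af`,
  `ρ₀` as in `IsAdmissibleKerrWave.exists_extend_eq_zero_of_lt`, a lower `C²` height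
  `0 ≤ F₁ ≤ h♯_{R₁}`, with `𝒥 = J^X[ψ̃] + ¼ L_ϖ[ψ̃]`, `f = u_{R',R'}(x⃗)`:
  `∫ ζ(T − t − h♯) f 𝒥·n^{h♯} |_{Σ̃_t} dy − ∫ ζ(T − s − F₁) f 𝒥·n^{F₁} |_{(s+F₁(y),y)} dy
     = ∫_y ∫_{(s+F₁(y), t+h♯(y)]} ( ζ(T − t') [ f · (K^{X,ϖ}[ψ̃]) + 𝒥·∂f ] − ζ'(T − t') f 𝒥⁰ ) dt' dy`,
  where `K^{X,ϖ} = K^X + ¼ ϖ G(dψ̃,dψ̃) − ⅛ (□ϖ) ψ̃²` is the bulk of the modified current — the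
  source term has been removed with `□ψ̃ = 0` on the far region (and `f = 0` off it).

No definitions, no named facts (D-0026).

## References

* G. Moschidis, arXiv:1509.08489, Lemma 4.1, Thm. 5.1 (key `Moschidis2016`).
* M. Dafermos, I. Rodnianski, Y. Shlapentokh-Rothman, arXiv:1402.7034, §2.3, Prop. 4.6.1
  (key `DafermosRodnianskiShlapentokhrothman2014`).
-/

noncomputable section

open Bundle Set TopologicalSpace Filter MeasureTheory Metric
open scoped Manifold ContDiff Topology ENNReal

namespace Literature.Geometry.Lorentzian

namespace Kerr

variable [Facts] [SliceFacts]

/-- **The far-region identity for a general cut-off modified current** (see the module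
docstring). [cite: DafermosRodnianskiShlapentokhrothman2014, §2.3 and Remark 2.3.1; Moschidis2016 Lemma 4.1 (proof)] -/
theorem far_cutoffCurrent_identity {M a R₁ R' : ℝ} (hMa : IsSubextremal M a) (hR₁ : 2 * M < R₁)
    (hR'af : afRadius a (rPlus M a) < R') {ψ : region a (rPlus M a) → ℝ}
    (hψ : IsAdmissibleKerrWave M a ψ) {ρ₀ : ℝ}
    (hρ₀ : ∀ x : E4, 0 ≤ x 0 → ρ₀ + x 0 < E4.spatialNorm x →
      Function.extend Subtype.val ψ 0 x = 0 ∧ fderiv ℝ (Function.extend Subtype.val ψ 0) x = 0)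
    {X : E4 → Fin 4 → ℝ} {ϖ : E4 → ℝ}
    (hX : ∀ x : E4, afRadius a (rPlus M a) < E4.spatialNorm x → ∀ α, ContDiffAt ℝ 1 (fun y ↦ X y α) x)
    (hϖ : ∀ x : E4, afRadius a (rPlus M a) < E4.spatialNorm x → ContDiffAt ℝ 2 ϖ x)
    {ζ : ℝ → ℝ} (hζ : ContDiff ℝ 1 ζ) (hζ0 : ∀ σ ≤ 0, ζ σ = 0)
    {F₁ : E3 → ℝ} (hF₁ : ContDiff ℝ 2 F₁) (hF₁0 : ∀ y, 0 ≤ F₁ y)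
    (hF₁h : ∀ y, F₁ y ≤ scriHeight M a R₁ y) {s t : ℝ} (hs : 0 ≤ s) (hst : s ≤ t) (T : ℝ) :
    (∫ y, ζ (T - (t + scriHeight M a R₁ y)) * (radialTransition R' R' y *
        ∑ μ, (KerrSchild.multiplierCurrent (inverseMetric M a) X (Function.extend Subtype.val ψ 0)
            (E4.ofTimeSpace (t + scriHeight M a R₁ y) y) μ +
          4⁻¹ * KerrSchild.lagrangianCurrent (inverseMetric M a) ϖ (Function.extend Subtype.val ψ 0)
            (E4.ofTimeSpace (t + scriHeight M a R₁ y) y) μ) * graphConormal (scriHeight M a R₁) y μ)) -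
      ∫ y, ζ (T - (s + F₁ y)) * (radialTransition R' R' y *
        ∑ μ, (KerrSchild.multiplierCurrent (inverseMetric M a) X (Function.extend Subtype.val ψ 0)
            (E4.ofTimeSpace (s + F₁ y) y) μ +
          4⁻¹ * KerrSchild.lagrangianCurrent (inverseMetric M a) ϖ (Function.extend Subtype.val ψ 0)
            (E4.ofTimeSpace (s + F₁ y) y) μ) * graphConormal F₁ y μ) =
      ∫ y, ∫ t' in Set.Ioc (s + F₁ y) (t + scriHeight M a R₁ y),
        (ζ (T - t') *
            (radialTransition R' R' y *
                (KerrSchild.multiplierBulk (inverseMetric M a) X (Function.extend Subtype.val ψ 0)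
                    (E4.ofTimeSpace t' y) +
                  4⁻¹ * (ϖ (E4.ofTimeSpace t' y) * ∑ α, ∑ β, inverseMetric M a (E4.ofTimeSpace t' y) α β *
                    fderiv ℝ (Function.extend Subtype.val ψ 0) (E4.ofTimeSpace t' y) (E4.basisVector α) *
                      fderiv ℝ (Function.extend Subtype.val ψ 0) (E4.ofTimeSpace t' y) (E4.basisVector β)) -
                  8⁻¹ * KerrSchild.waveOperator (inverseMetric M a) ϖ (E4.ofTimeSpace t' y) *
                    Function.extend Subtype.val ψ 0 (E4.ofTimeSpace t' y) ^ 2) +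
              ∑ μ, (KerrSchild.multiplierCurrent (inverseMetric M a) X (Function.extend Subtype.val ψ 0)
                    (E4.ofTimeSpace t' y) μ +
                  4⁻¹ * KerrSchild.lagrangianCurrent (inverseMetric M a) ϖ (Function.extend Subtype.val ψ 0)
                    (E4.ofTimeSpace t' y) μ) *
                fderiv ℝ (fun x : E4 ↦ radialTransition R' R' (E4.spatial x)) (E4.ofTimeSpace t' y)
                  (E4.basisVector μ)) -
          deriv ζ (T - t') * (radialTransition R' R' y *
            (KerrSchild.multiplierCurrent (inverseMetric M a) X (Function.extend Subtype.val ψ 0)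
                (E4.ofTimeSpace t' y) 0 +
              4⁻¹ * KerrSchild.lagrangianCurrent (inverseMetric M a) ϖ (Function.extend Subtype.val ψ 0)
                (E4.ofTimeSpace t' y) 0))) := by
  have hM : 0 < M := hMa.pos
  have hR' : 0 < R' := (afRadius_pos a (rPlus M a)).trans hR'af
  have hRp : rPlus M a < R₁ := (rPlus_le_two_mul hM.le).trans_lt hR₁
  set Φ : E4 → ℝ := Function.extend Subtype.val ψ 0 with hΦ
  set f : E4 → ℝ := fun x ↦ radialTransition R' R' (E4.spatial x) with hf
  set U : Set E4 := {x | afRadius a (rPlus M a) < E4.spatialNorm x} with hU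
  set h : E3 → ℝ := scriHeight M a R₁ with hh
  have hfU : tsupport f ⊆ U := fun x hx ↦
    hR'af.trans_le (tsupport_radialTransition_comp_spatial_subset hR' hx)
  have hf1 : ContDiff ℝ 1 f := contDiff_radialTransition_comp_spatial hR'
  have hmemU : ∀ x ∈ U, x ∈ region a (rPlus M a) := fun x hx ↦ mem_region_of_afRadius_lt_spatialNorm hx
  have hG : ∀ x ∈ U, ∀ μ ν, ContDiffAt ℝ 1 (fun y ↦ inverseMetric M a y μ ν) x := fun x hx μ ν ↦
    contDiffAt_inverseMetric M a (radius_pos_of_mem_region (hmemU x hx)) μ ν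
  have hsymm : ∀ x ∈ U, ∀ μ ν, inverseMetric M a x μ ν = inverseMetric M a x ν μ := fun x _ μ ν ↦
    inverseMetric_symm M a x μ ν
  have hX' : ∀ x ∈ U, ∀ α, ContDiffAt ℝ 1 (fun y ↦ X y α) x := fun x hx α ↦ hX x hx α
  have hϖ' : ∀ x ∈ U, ContDiffAt ℝ 2 ϖ x := fun x hx ↦ hϖ x hx
  have hw : ∀ x ∈ U, ContDiffAt ℝ 2 Φ x := fun x hx ↦ hψ.contDiffAt_extend_of_mem (hmemU x hx)
  have hF : ContDiff ℝ 2 h := hMa.contDiff_scriHeight hRp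
  have hF₂ : ContDiff ℝ 2 fun y ↦ (t - s) + h y := contDiff_const.add hF
  have hle : ∀ y, F₁ y ≤ (t - s) + h y := fun y ↦ by linarith [hF₁h y, sub_nonneg.2 hst]
  have hfar : ∀ x : E4, ρ₀ + T < E4.spatialNorm x → s + F₁ (E4.spatial x) ≤ x 0 →
      x 0 ≤ s + ((t - s) + h (E4.spatial x)) → x 0 < T → f x = 0 ∨ (Φ x = 0 ∧ fderiv ℝ Φ x = 0) := by
    intro x hxρ hx1 _ hxT
    right
    have hx0 : 0 ≤ x 0 := by linarith [hF₁0 (E4.spatial x)]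
    exact hρ₀ x hx0 (by linarith)
  have hid := KerrSchild.cutoffModifiedCurrent_graphs_identity_timeCutoff (G := inverseMetric M a)
    (X := X) (ϖ := ϖ) (w := Φ) (f := f) hfU hf1 hG hsymm hX' hϖ' hw hζ hζ0 hF₁ hF₂ hle
    (τ := s) (T := T) hfar
  have hfval : ∀ (τ : ℝ) (y : E3), f (E4.ofTimeSpace τ y) = radialTransition R' R' y := by
    intro τ y
    simp [hf]
  have hn : ∀ (y : E3) (μ : Fin 4),
      graphConormal (fun y ↦ t - s + h y) y μ = graphConormal h y μ := by
    intro y μ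
    refine Fin.cases rfl (fun i ↦ ?_) μ
    simp only [graphConormal_succ, partialE3, fderiv_const_add]
  simp only [show ∀ y, s + (t - s + h y) = t + h y from fun y ↦ by ring, hfval, hn] at hid
  rw [hid]
  -- the source term vanishes: `□ψ̃ = 0` on `U`, `f = 0` off `tsupport f`
  refine congrArg (fun g : E3 → ℝ ↦ ∫ y, g y) (funext fun y ↦ ?_)
  refine setIntegral_congr_fun measurableSet_Ioc fun t' _ ↦ ?_
  have hkey : radialTransition R' R' y *
      (((∑ α, X (E4.ofTimeSpace t' y) α * fderiv ℝ Φ (E4.ofTimeSpace t' y) (E4.basisVector α)) +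
          4⁻¹ * (ϖ (E4.ofTimeSpace t' y) * Φ (E4.ofTimeSpace t' y))) *
        KerrSchild.waveOperator (inverseMetric M a) Φ (E4.ofTimeSpace t' y)) = 0 := by
    by_cases hx : E4.ofTimeSpace t' y ∈ U
    · rw [hψ.waveOperator_extend_eq_zero (hmemU _ hx)]
      ring
    · have hx' : E4.ofTimeSpace t' y ∉ tsupport f := fun h' ↦ hx (hfU h')
      rw [← hfval t' y, image_eq_zero_of_notMem_tsupport hx', zero_mul]
  have hsplit : radialTransition R' R' y *
      ((((∑ α, X (E4.ofTimeSpace t' y) α * fderiv ℝ Φ (E4.ofTimeSpace t' y) (E4.basisVector α)) +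
          4⁻¹ * (ϖ (E4.ofTimeSpace t' y) * Φ (E4.ofTimeSpace t' y))) *
        KerrSchild.waveOperator (inverseMetric M a) Φ (E4.ofTimeSpace t' y)) +
      (KerrSchild.multiplierBulk (inverseMetric M a) X Φ (E4.ofTimeSpace t' y) +
        4⁻¹ * (ϖ (E4.ofTimeSpace t' y) * ∑ α, ∑ β, inverseMetric M a (E4.ofTimeSpace t' y) α β *
          fderiv ℝ Φ (E4.ofTimeSpace t' y) (E4.basisVector α) *
            fderiv ℝ Φ (E4.ofTimeSpace t' y) (E4.basisVector β)) -
        8⁻¹ * KerrSchild.waveOperator (inverseMetric M a) ϖ (E4.ofTimeSpace t' y) *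
          Φ (E4.ofTimeSpace t' y) ^ 2)) =
      radialTransition R' R' y *
        (KerrSchild.multiplierBulk (inverseMetric M a) X Φ (E4.ofTimeSpace t' y) +
          4⁻¹ * (ϖ (E4.ofTimeSpace t' y) * ∑ α, ∑ β, inverseMetric M a (E4.ofTimeSpace t' y) α β *
            fderiv ℝ Φ (E4.ofTimeSpace t' y) (E4.basisVector α) *
              fderiv ℝ Φ (E4.ofTimeSpace t' y) (E4.basisVector β)) -
          8⁻¹ * KerrSchild.waveOperator (inverseMetric M a) ϖ (E4.ofTimeSpace t' y) *
            Φ (E4.ofTimeSpace t' y) ^ 2) := by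
    rw [mul_add, hkey, zero_add]
  rw [hsplit]

end Kerr

end Literature.Geometry.Lorentzian
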